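import Summits.AtomisticToContinuum.BoseEinsteinCondensation.Theses.BECPalmDirectCorrelation
import Summits.AtomisticToContinuum.BoseEinsteinCondensation.Theorems.BECPalmDirectCorrelationStructureFactorFloorRigidity
import HarnessLib.Audit

/-!
# Crux `GaussianPalmBound` (stmt-AtomisticToContinuum-12225) — birth skeleton (BC3), line `birth`

Route `BECPalmDirectCorrelation` (rank-3 crux): uniformly in large `N = n+1`, some slack `δ > 0` makes
every `δ`-near-minimiser `Ψ` of the periodic problem on the torus of side `L = (N/ρ)^{1/3}` satisfy
`G(Ψ) = Σ_{m≠0} (S_m − 1)²/((n−1)S_m + 1) ≤ C`, `S_m = N⁻¹∫_{cell^N}|Σⱼ e_m(xⱼ)|²|Ψ|²`.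

The line is the route's own foreseen glued split (route header, TWO-LAYER PLAN:
`GaussianPalmBound ⇐ StructureFactorFloor → PairCorrelationL2 → lattice-sum glue`), typed as three
registered stubs (literal `let`-free signatures, fully qualified, so a `Theorems/` file can restate them
verbatim with no `open`):

* `stub_structureFactorFloor` — INFRARED half = the support item `StructureFactorFloor`
  (stmt-AtomisticToContinuum-12228) BY NAME: `S_m ≥ c·min(ℓ|m|/L, 1)` for `m ≠ 0` on near-minimisers
  (no soft-mode collapse `S = o(k)`; sum rules `m₀ ≥ m₁²/m₂`, `m₂ ≤ √(m₁m₃)`).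
* `stub_pairCorrelationL2` — ULTRAVIOLET / clustering half (`PairCorrelationL2` of the plan):
  `Σ_{m≠0} (S_m − 1)² ≤ A·N` on near-minimisers, i.e. `g − 1 ∈ L²(cell)` uniformly in `N`
  (Parseval: `Σ_{m≠0}(S_m − 1)² = ρN∫_cell (g − 1)² − 1` for a translation-invariant state; no Bragg peak).
  Same quantifier shape as the crux (`∃ A ∀ᶠ n ∃ δ ∀ δ-near-minimisers`), with `L` and `S_m` written out.
* `stub_latticeSum` — the deterministic `d = 3` lattice-sum estimate (the plan's "glue"): a real sequence
  `s` on `ℤ³` with that floor and that `ℓ²` bound has `Σ_{m≠0}(s_m − 1)²/((n−1)s_m + 1) ≤ K(ρ,c,ℓ,A)`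
  eventually in `n`.  Why true: far modes `ℓ|m| ≥ L` have denominator `≥ (n−1)min(c,1) + 1`, total
  `≤ 3·max(A,0)/min(c,1)`; near modes with `s_m ≥ 1` have denominator `≥ n`, total `≤ 2·max(A,0)`; near
  modes with `s_m < 1` have numerator `≤ 1` and `Σ_{0<|m|<L/ℓ} L/((n−1)cℓ|m|) ≤ 26L³/((n−1)cℓ³) ≤ 78/(ρcℓ³)`
  (`#{m ∈ ℤ³ : ‖m‖_∞ = j} ≤ 26j²`, `L³ = N/ρ`).  This is where `d = 3` enters (`d = 1`: `log L`).
  (A version over `S : ℤ³ → ℝ≥0∞` WITHOUT `S_m ≠ ⊤` would be false — `toReal ⊤ = 0` — hence the real `s`.)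

`GaussianPalmBound_of` is the sorry-free composition, hypotheses BY NAME (`StructureFactorFloor` and the
`Goal.stub_*` statement abbrevs, whose bodies are the stub signatures verbatim — `GaussianPalmBound_of_stubs`
type-checks that): bookkeeping of `ρ₀, C, n, δ`, plus finiteness `S_m ≤ N < ⊤`
(`Theorems.StructureFactorFloor.lintegral_weight_sq_le`) to pass from the `ℝ≥0∞` floor to the real one.
Disproof used: none on file for this crux (`ledger crux ls`: no `Disproof.lean`, 2026-08-17).
BC3 probes (planner folder `bc/GaussianPalmBound_probes.lean`, `…_probe2a_split.lean`): for each stub `X`,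
`X → GaussianPalmBound` and `X → BoseEinsteinCondensation` by `first | exact? | simpa | aesop` FAIL (6/6).
-/

namespace Summit.AtomisticToContinuum.BoseEinsteinCondensation.Cruxes.GaussianPalmBound.Birth

open MeasureTheory Filter
open scoped ENNReal NNReal BigOperators
open Literature.MathematicalPhysics.QuantumManyBody.BoseGas

/-! ### Statements of the stubs BY NAME (audit names; bodies = the stub signatures verbatim) -/

namespace Goal

/-- Statement of `stub_pairCorrelationL2` (UV / clustering half: `Σ_{m≠0}(S_m − 1)² ≤ A·N` on near-minimisers). -/
abbrev stub_pairCorrelationL2 : Prop :=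
  ∀ v : ℝ → ENNReal, Literature.MathematicalPhysics.QuantumManyBody.BoseGas.IsRepulsiveFiniteRange v → ∃ ρ₀ : ℝ, 0 < ρ₀ ∧ ∀ ρ : ℝ, 0 < ρ → ρ < ρ₀ → ∃ A : ℝ, ∀ᶠ n : ℕ in Filter.atTop, ∃ δ : ENNReal, 0 < δ ∧ ∀ Ψ : Literature.MathematicalPhysics.QuantumManyBody.BoseGas.PeriodicTrialState (n + 1) (Literature.MathematicalPhysics.QuantumManyBody.BoseGas.sideLength ρ (n + 1)), Literature.MathematicalPhysics.QuantumManyBody.BoseGas.periodicEnergy v Ψ ≤ Literature.MathematicalPhysics.QuantumManyBody.BoseGas.periodicGroundStateEnergy v (n + 1) (Literature.MathematicalPhysics.QuantumManyBody.BoseGas.sideLength ρ (n + 1)) + δ → (∑' m : Fin 3 → ℤ, (if m = 0 then (0 : ENNReal) else ENNReal.ofReal (((((n + 1 : ℕ) : ENNReal)⁻¹ * (∫⁻ X in Literature.MathematicalPhysics.QuantumManyBody.BoseGas.cellN (n + 1) (Literature.MathematicalPhysics.QuantumManyBody.BoseGas.sideLength ρ (n + 1)), (‖∑ j : Fin (n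 + 1), Literature.MathematicalPhysics.QuantumManyBody.BoseGas.cellWave (Literature.MathematicalPhysics.QuantumManyBody.BoseGas.sideLength ρ (n + 1)) m (X j)‖₊ : ENNReal) ^ 2 * (‖Ψ.ψ X‖₊ : ENNReal) ^ 2)).toReal - 1) ^ 2))) ≤ ENNReal.ofReal (A * (n + 1))

/-- Statement of `stub_latticeSum` (the `d = 3` lattice-sum estimate). -/
abbrev stub_latticeSum : Prop :=
  ∀ ρ c ℓ A : ℝ, 0 < ρ → 0 < c → 0 < ℓ → ∃ K : ℝ, ∀ᶠ n : ℕ in Filter.atTop, ∀ s : (Fin 3 → ℤ) → ℝ, (∀ m : Fin 3 → ℤ, m ≠ 0 → c * min (ℓ * ‖Literature.MathematicalPhysics.QuantumManyBody.BoseGas.latticeVec (Literature.MathematicalPhysics.QuantumManyBody.BoseGas.sideLength ρ (n + 1))⁻¹ m‖) 1 ≤ s m) → (∑' m : Fin 3 → ℤ, (if m = 0 then (0 : ENNReal) else ENNReal.ofReal ((s m - 1) ^ 2))) ≤ ENNReal.ofReal (A * (n + 1)) → (∑' m : Fin 3 → ℤ, (if m = 0 then (0 : ENNReal) else ENNReal.ofReal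 ((s m - 1) ^ 2 / (((n - 1 : ℕ) : ℝ) * s m + 1)))) ≤ ENNReal.ofReal K

end Goal

/-! ### Registered stubs (the only `sorry`s of this file) -/

/-- **Stub 1 (infrared floor) = support item `StructureFactorFloor` (stmt-AtomisticToContinuum-12228), by name.**
For every repulsive finite-range `v` and small `ρ` there are `c, ℓ > 0` such that for all large
`N = n+1` some `δ > 0` makes every `δ`-near-minimiser satisfy `S_m ≥ c·min(ℓ|m|/L, 1)` for all `m ≠ 0`. -/
theorem stub_structureFactorFloor : Summit.AtomisticToContinuum.BoseEinsteinCondensation.Theses.BECPalmDirectCorrelation.StructureFactorFloor := by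
  sorry

/-- **Stub 2 (ultraviolet / clustering half, `PairCorrelationL2`).** For every repulsive finite-range
`v` and small `ρ` there is `A` such that for all large `N = n+1` some `δ > 0` makes every
`δ`-near-minimiser satisfy `Σ_{m≠0} (S_m − 1)² ≤ A·N` (`g − 1 ∈ L²(cell)` uniformly in `N`). -/
theorem stub_pairCorrelationL2 : ∀ v : ℝ → ENNReal, Literature.MathematicalPhysics.QuantumManyBody.BoseGas.IsRepulsiveFiniteRange v → ∃ ρ₀ : ℝ, 0 < ρ₀ ∧ ∀ ρ : ℝ, 0 < ρ → ρ < ρ₀ → ∃ A : ℝ, ∀ᶠ n : ℕ in Filter.atTop, ∃ δ : ENNReal, 0 < δ ∧ ∀ Ψ : Literature.MathematicalPhysics.QuantumManyBody.BoseGas.PeriodicTrialState (n + 1) (Literature.MathematicalPhysics.QuantumManyBody.BoseGas.sideLength ρ (n + 1)), Literature.MathematicalPhysics.QuantumManyBody.BoseGas.periodicEnergy v Ψ ≤ Literature.MathematicalPhysics.QuantumManyBody.BoseGas.periodicGroundStateEnergy v (n + 1) (Literature.MathematicalPhysics.QuantumManyBody.BoseGas.sideLength ρ (n + 1)) + δ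 → (∑' m : Fin 3 → ℤ, (if m = 0 then (0 : ENNReal) else ENNReal.ofReal (((((n + 1 : ℕ) : ENNReal)⁻¹ * (∫⁻ X in Literature.MathematicalPhysics.QuantumManyBody.BoseGas.cellN (n + 1) (Literature.MathematicalPhysics.QuantumManyBody.BoseGas.sideLength ρ (n + 1)), (‖∑ j : Fin (n + 1), Literature.MathematicalPhysics.QuantumManyBody.BoseGas.cellWave (Literature.MathematicalPhysics.QuantumManyBody.BoseGas.sideLength ρ (n + 1)) m (X j)‖₊ : ENNReal) ^ 2 * (‖Ψ.ψ X‖₊ : ENNReal) ^ 2)).toReal - 1) ^ 2))) ≤ ENNReal.ofReal (A * (n + 1)) := by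
  sorry

/-- **Stub 3 (the `d = 3` lattice-sum estimate).** For `ρ, c, ℓ > 0` and `A` there is `K` such that
for all large `n`, with `L = (N/ρ)^{1/3}`, every real sequence `s` on `ℤ³` with the infrared floor
`s_m ≥ c·min(ℓ|m|/L, 1)` (`m ≠ 0`) and the `ℓ²` bound `Σ_{m≠0}(s_m − 1)² ≤ A·N` has
`Σ_{m≠0} (s_m − 1)²/((n−1)s_m + 1) ≤ K`. -/
theorem stub_latticeSum : ∀ ρ c ℓ A : ℝ, 0 < ρ → 0 < c → 0 < ℓ → ∃ K : ℝ, ∀ᶠ n : ℕ in Filter.atTop, ∀ s : (Fin 3 → ℤ) → ℝ, (∀ m : Fin 3 → ℤ, m ≠ 0 → c * min (ℓ * ‖Literature.MathematicalPhysics.QuantumManyBody.BoseGas.latticeVec (Literature.MathematicalPhysics.QuantumManyBody.BoseGas.sideLength ρ (n + 1))⁻¹ m‖) 1 ≤ s m) → (∑' m : Fin 3 → ℤ, (if m = 0 then (0 : ENNReal) else ENNReal.ofReal ((s m - 1) ^ 2))) ≤ ENNReal.ofReal (A * (n + 1)) → (∑' m : Fin 3 → ℤ, (if m = 0 then (0 :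 ENNReal) else ENNReal.ofReal ((s m - 1) ^ 2 / (((n - 1 : ℕ) : ℝ) * s m + 1)))) ≤ ENNReal.ofReal K := by
  sorry

/-! ### Composition (no `sorry` below this line) -/

/-- **The three stubs imply the crux `GaussianPalmBound` BY NAME** (hypotheses by name: the route item
`StructureFactorFloor` and the statement abbrevs `Goal.stub_pairCorrelationL2`, `Goal.stub_latticeSum`).
`ρ₀ = min ρ₀ᴵᴿ ρ₀ᵁⱽ`, `C = K(ρ, c, ℓ, A)`, intersect the three eventual-`n` sets, `δ = min δᴵᴿ δᵁⱽ`;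
the `ℝ≥0∞` floor passes to the real floor because `S_m ≤ N < ⊤`
(`StructureFactorFloor.lintegral_weight_sq_le`). [folklore] -/
theorem GaussianPalmBound_of :
    Summit.AtomisticToContinuum.BoseEinsteinCondensation.Theses.BECPalmDirectCorrelation.StructureFactorFloor →
    Goal.stub_pairCorrelationL2 → Goal.stub_latticeSum →
    Summit.AtomisticToContinuum.BoseEinsteinCondensation.Theses.BECPalmDirectCorrelation.GaussianPalmBound := by
  intro hIR hUV hLat v hv
  obtain ⟨ρ₁, hρ₁, h1⟩ := hIR v hv
  obtain ⟨ρ₂, hρ₂, h2⟩ := hUV v hv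
  refine ⟨min ρ₁ ρ₂, lt_min hρ₁ hρ₂, fun ρ hρ hρlt => ?_⟩
  obtain ⟨c, ℓ, hc, hℓ, h1⟩ := h1 ρ hρ (lt_of_lt_of_le hρlt (min_le_left _ _))
  obtain ⟨A, h2⟩ := h2 ρ hρ (lt_of_lt_of_le hρlt (min_le_right _ _))
  obtain ⟨K, hK⟩ := hLat ρ c ℓ A hρ hc hℓ
  refine ⟨K, ?_⟩
  filter_upwards [h1, h2, hK] with n hn1 hn2 hn3
  dsimp only at hn1 ⊢
  obtain ⟨δ₁, hδ₁, H1⟩ := hn1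
  obtain ⟨δ₂, hδ₂, H2⟩ := hn2
  refine ⟨min δ₁ δ₂, lt_min hδ₁ hδ₂, fun Ψ hΨ => ?_⟩
  have hΨ1 := H1 Ψ (hΨ.trans (add_le_add le_rfl (min_le_left _ _)))
  have hΨ2 := H2 Ψ (hΨ.trans (add_le_add le_rfl (min_le_right _ _)))
  -- finiteness of the cell structure factor: `S_m ≤ N < ⊤`
  have hfin : ∀ m : Fin 3 → ℤ, ((n + 1 : ℕ) : ℝ≥0∞)⁻¹ *
      (∫⁻ X in cellN (n + 1) (sideLength ρ (n + 1)),
        (‖∑ j : Fin (n + 1), cellWave (sideLength ρ (n + 1)) m (X j)‖₊ : ℝ≥0∞) ^ 2 *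
          (‖Ψ.ψ X‖₊ : ℝ≥0∞) ^ 2) ≠ ⊤ := fun m =>
    ENNReal.mul_ne_top (ENNReal.inv_ne_top.2 (by exact_mod_cast Nat.succ_ne_zero n))
      (ne_top_of_le_ne_top (ENNReal.pow_ne_top ENNReal.coe_ne_top)
        (Theorems.StructureFactorFloor.lintegral_weight_sq_le (sideLength ρ (n + 1)) m Ψ))
  refine hn3 _ (fun m hm => ?_) hΨ2
  exact (ENNReal.ofReal_le_iff_le_toReal (hfin m)).1 (hΨ1 m hm)

/-- The skeleton as a proof of the crux THROUGH the sorried stubs (it also type-checks that the stub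
signatures are the `Goal` statements verbatim).  Becomes a proof of stmt-AtomisticToContinuum-12225 once
the three stubs land sorry-free. [folklore] -/
theorem GaussianPalmBound_of_stubs : Summit.AtomisticToContinuum.BoseEinsteinCondensation.Theses.BECPalmDirectCorrelation.GaussianPalmBound :=
  GaussianPalmBound_of stub_structureFactorFloor stub_pairCorrelationL2 stub_latticeSum

end Summit.AtomisticToContinuum.BoseEinsteinCondensation.Cruxes.GaussianPalmBound.Birth
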